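import Summits.HodgeConjecture.CorCM.Stage4StrictRoadTransitivity
import Summits.HodgeConjecture.HodgeConjecture.Theorems.Ring2HypothesesDescentMotivatedCorrespondences
import Literature.AlgebraicGeometry.HodgeTheory.MotivatedClassesTransport
import Literature.AlgebraicGeometry.HodgeTheory.MotivatedClassesPointAuxiliary
import HarnessLib

/-!
# Ring 2 hypotheses, descent face — ARAPURA'S LEMMA 4.2, CLAUSE `AC` («Hodge classes are motivated»), ALONG DOMINATION
# BY POWERS, and COR. 4.4 (strong form): `AC` on Arapura's strict abelian class MODULO André's Thm. 0.6.2 (c2)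

research route conditional on HC_CM; not a corollary; Q11.4-sentence-2 already refuted in dim ≥ 3.
Cell `pub-hodge-ring2` (Hodge ladder STAGE 3), seat `ring2-b05` (binder row b05
`Ring2.Hypotheses.MotivatedImpliesAlgebraicAV`, `Ring2HypothesesDescent.lean` :177), gen 41, third file (companions:
`Ring2HypothesesDescentStandardDDomination` — clauses `D`, `B`; `Ring2HypothesesDescentStandardBStrictAbelian` — the
unconditional instances). `HC_CM` (`Theses.RankFourFaces.CMAbelianHodge`) does not occur in this file; nothing here proves
a case of the Hodge conjecture; no binder of `BINDER-OWNERS.md` is discharged; row b05 stays OPEN and is not asserted;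
the named fact c2 `Andre1996_hodgeClasses_abelianVariety_motivated` (André 1996 Thm. 0.6.2, a THEOREM in print) occurs
only as the displayed hypothesis `hAM` of §2–§3.

D. Arapura, *Motivation for Hodge cycles*, Adv. Math. 207 (2006), §4: `AC(X)` — «All Hodge cycles on `X` are motivated
in the widest sense»; Lemma 4.2, last clause: «If `Y` is weakly motivated by `X` and `AC` holds for all powers of `X`,
then it holds for all powers of `Y`»; Cor. 4.4: «If `X` is weakly motivated by an Abelian variety, then `AC` holds for
`X` and all its powers» (proof: André's Thm. 0.6.2). The tree renders (strong) motivation by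
`HodgeTheory.IsDominatedByPowers` (Arapura's Lemma 1.1 with ALGEBRAIC correspondences); this file proves the clause `AC`
in that rendering, by the engine of the tree's HC-clause discharge (`CorCM.Stage4.hodgeConjectureFor_of_isDominatedByPowers`:
a rational `(p,p)`-class carried by finitely many rational algebraic correspondences `(γᵢ)_*` from powers `X^{eᵢ}` is
`Σ (γᵢ)_* aᵢ` with `aᵢ` rational of type `(dᵢ,dᵢ)` — semisimplicity of polarisable Hodge structures,
`CorCM.Stage4.exists_isRationalClass_isOfHodgeType_eq_sum_int`), with the last step «`(γᵢ)_*` preserves ALGEBRAIC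
classes» replaced by «`(γᵢ)_*` preserves MOTIVATED classes» (André Prop. 2.1 Corollaire, gen 34's
`Ring2.Hypotheses.map_mem_motivatedClasses_of_isAlgebraicCorrespondence`).

* §1 **`hodgeClasses_motivated_of_isDominatedByPowers` — CLAUSE `AC`**: `Y` dominated by the powers of `X`, every
  rational `(d,d)`-class on every power `Xᵉ` motivated ⟹ every rational `(p,p)`-class on `Y` is motivated.
* §2 `hodgeClasses_pow_motivated_of_andre1996` — c2 ⟹ `AC` on every cartesian power `A.Xᵉ` of a complex abelian variety
  (transport along `CorCM.Stage4.powSuccXIso`; `A.X⁰ = Spec ℂ` by `A ⊆ A_mot`).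
* §3 **`hodgeClasses_motivated_of_exists_isDominatedByPowers_abelianVariety` — COR. 4.4 (strong form) MODULO c2**: every
  Hodge class on a variety dominated by the powers of an abelian variety is MOTIVATED, with all powers, products and
  smooth surjective images — the motivated twin of the tree's `CorCM.Stage4.hc_of_exists_isDominatedByPowers_abelianVariety`
  (`HC_AV ⟹ HC` on the strict class).

READING FOR ROW b05 (docstring only). On the strict abelian class the three printed steps «Hodge ⟹ motivated ⟹
algebraic» now read: Hodge ⟹ motivated MODULO c2 (§3); motivated-MODELLED-ON-THE-CLASS ⟹ algebraic UNCONDITIONALLY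
(companion file §4); motivated (all auxiliaries) ⟹ algebraic ⟺ row b05 (gen 40). HONEST COLUMN: no definition, no NEW
named fact, no sorry; c2 displayed, never asserted; Arapura's WEAK motivation (K3 / hyperkähler, motivated correspondences
as dominators) is NOT covered — the engine needs rational algebraic correspondences.

PRESEARCH: [corpus: `paper:arxiv-math_0501348` Arapura 2006 §4 Lemma 4.2 (last clause) and Cor. 4.4, re-opened this
session] — certification on the carriers in the strong-domination rendering, no novelty in print claimed.

References (bib keys): Arapura2006 (§1 Lemma 1.1, §4 Lemma 4.2, Cor. 4.4), Andre1996Motifs (Thm. 0.6.2 (p. 9), Prop. 2.1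
Corollaire (p. 15)), Voisin2025 (Prop. 2.11, Cor. 2.12), VoisinHodgeI2002 (§7.3.2, Lemma 11.41), VoisinHodgeII2003
(Prop. 9.20–9.21, (10.7)), FloccariVaresco2024 (Rem. 2.2).
-/

noncomputable section

-- every declaration of this problem lives in `Summit.HodgeConjecture.HodgeConjecture.…` (summit = sub-problem)
set_option linter.dupNamespace false

open CategoryTheory AlgebraicGeometry MonoidalCategory CartesianMonoidalCategory
open Literature.AlgebraicTopology.SingularHomology Literature.Geometry.Kaehler
open Literature.AlgebraicGeometry Literature.AlgebraicGeometry.Motives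
  Literature.AlgebraicGeometry.HodgeTheory
open Summit.HodgeConjecture.CorCM.Stage4 (exists_isRationalClass_isOfHodgeType_eq_sum_int
  span_rationalAlgebraicCorrRanges_eq_top isRationalClass_corrAction_complex isOfHodgeType_corrAction_complex
  corrAction_eq_zero_of_hodgeType_lt powSuccXIso dim_powSucc' isDominatedByPowers_pow_succ isDominatedByPowers_tensor
  exists_isDominatedByPowers_of_surjective)

namespace Summit.HodgeConjecture.HodgeConjecture.Theorems

variable {dX dY : ℕ} {X Y : SchemeOver ℂ}

/-! ## §1 Clause `AC`: «Hodge classes are motivated» descends along domination by powers -/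

/-- **ARAPURA'S LEMMA 4.2, CLAUSE `AC`, on the real carriers (strong domination).** Let `Y` (smooth projective,
dimension `dY`) be dominated by the powers of `X` (dimension `dX`) through algebraic correspondences, and suppose that on
every cartesian power `Xᵉ` every rational class of type `(d,d)` is MOTIVATED (`AC(Xᵉ)`; `X⁰ = Spec ℂ` included). Then
every rational `(p,p)`-class `c` on `Y` is motivated. Proof: `c` is carried by finitely many RATIONAL algebraic
correspondences `(γᵢ)_*` from powers `X^{eᵢ}` (`CorCM.Stage4.span_rationalAlgebraicCorrRanges_eq_top`); these are rational
Hodge-linear maps with integer Tate twists killing the types they cannot shift, so `c = Σ (γᵢ)_* aᵢ` with `aᵢ` rational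
of type `(dᵢ,dᵢ)` (semisimplicity of polarisable Hodge structures, `CorCM.Stage4.exists_isRationalClass_isOfHodgeType_eq_sum_int`);
the `aᵢ` are motivated by hypothesis and `(γᵢ)_*` preserves motivated classes (André Prop. 2.1 Corollaire,
`Ring2.Hypotheses.map_mem_motivatedClasses_of_isAlgebraicCorrespondence`). The hypothesis `AC(Xᵉ)` is NOT asserted.
[cite: Arapura2006, §4 Lemma 4.2 and §1 Lemma 1.1] [cite: Voisin2025, Prop. 2.11 and Cor. 2.12]
[cite: Andre1996Motifs, Prop. 2.1 Corollaire (p. 15)] -/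
theorem hodgeClasses_motivated_of_isDominatedByPowers (hX : IsSmoothProjective dX X) (hY : IsSmoothProjective dY Y)
    (hdom : IsDominatedByPowers dY Y dX X)
    (hAC : ∀ (e d : ℕ) (a : complexBetti (X.pow e) (2 * d)), IsRationalClass a →
      IsOfHodgeType (e * dX) (X.pow e) (2 * d) d d a → a ∈ motivatedClasses (e * dX) (X.pow e) d)
    (p : ℕ) {c : complexBetti Y (2 * p)} (hc : IsRationalClass c) (hpp : IsOfHodgeType dY Y (2 * p) p p c) :
    c ∈ motivatedClasses dY Y p := by
  classical
  -- degrees beyond `2 dim Y`: nothing to prove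
  by_cases hp : 2 * dY < 2 * p
  · haveI := subsingleton_complexBetti hY hp
    rw [Subsingleton.elim c 0]
    exact Submodule.zero_mem _
  obtain ⟨k, hk⟩ : ∃ k, 2 * p + k = 2 * dY := ⟨2 * dY - 2 * p, by omega⟩
  -- a finite family of rational algebraic correspondences carrying `c`
  have hc1 := (span_rationalAlgebraicCorrRanges_eq_top hX hY hdom p).symm ▸ Submodule.mem_top (x := c)
  obtain ⟨T, hTS, hcT⟩ := Submodule.mem_span_finite_of_mem_span hc1
  have hdata : ∀ t : T, ∃ (e cd d : ℕ) (hab : 2 * d + 2 * cd = 2 * p + 2 * (e * dX))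
      (γ : complexBetti (Y ⊗ X.pow e) (2 * cd)),
      IsRationalClass γ ∧ γ ∈ algebraicClasses (Y ⊗ X.pow e) cd ∧
        (t : complexBetti Y (2 * p)) ∈
          LinearMap.range (corrAction complexOrientationFamily hY (hX.pow e) hab γ) :=
    fun t ↦ hTS t.2
  choose e cd d hab γ hγr hγa hγt using hdata
  -- the Hodge-structure engine for the family `(γ t)_*`, twists `cd t − e t · dX`
  obtain ⟨a, ha, hsum⟩ := exists_isRationalClass_isOfHodgeType_eq_sum_int hY
    (ι := T) (m := fun t ↦ e t * dX) (d := d) (Y := fun t ↦ X.pow (e t)) (fun t ↦ hX.pow (e t)) p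
    (fun t ↦ (cd t : ℤ) - (e t * dX : ℕ)) (fun t ↦ by have := hab t; push_cast; omega)
    (fun t ↦ corrAction complexOrientationFamily hY (hX.pow (e t)) (hab t) (γ t))
    (fun t y hy ↦ isRationalClass_corrAction_complex hY (hX.pow (e t)) (hab t) (hγr t) hy)
    (fun t p₀ q₀ y _ hy p₁ q₁ hp₁ hq₁ ↦ isOfHodgeType_corrAction_complex hY (hX.pow (e t)) (hab t)
      (isOfHodgeType_of_mem_algebraicClasses_of_isSmoothProjective
        (IsSmoothProjective.tensor_holds hY (hX.pow (e t))) (cd t) (hγa t))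
      (by push_cast at hp₁; omega) (by push_cast at hq₁; omega) hy)
    (fun t p₀ q₀ y _ hy hlt ↦ corrAction_eq_zero_of_hodgeType_lt hY (hX.pow (e t)) (hab t)
      (isOfHodgeType_of_mem_algebraicClasses_of_isSmoothProjective
        (IsSmoothProjective.tensor_holds hY (hX.pow (e t))) (cd t) (hγa t))
      (by push_cast at hlt; omega) hy)
    hc hpp (Submodule.span_le.2 (fun t ht ↦ Submodule.mem_iSup_of_mem (⟨t, ht⟩ : T) (hγt ⟨t, ht⟩)) hcT)
  -- each summand is motivated: `a t` is, and `(γ t)_*` preserves motivated classes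
  rw [hsum]
  refine Submodule.sum_mem _ fun t _ ↦ ?_
  exact Ring2.Hypotheses.map_mem_motivatedClasses_of_isAlgebraicCorrespondence hY (hX.pow (e t))
    (isAlgebraicCorrespondence_corrAction complexOrientationFamily hasPoincareDuality_complexOrientationFamily hY
      (hX.pow (e t)) (hab t) hk (hγa t))
    (hAC (e t) (d t) (a t) (ha t).1 (ha t).2)

/-- **The powers clause of `AC`**: under the same hypotheses every rational `(p,p)`-class on every positive cartesian power
`Y^{j+1}` is motivated (the power is dominated by the powers of `X`, `CorCM.Stage4.isDominatedByPowers_pow_succ`).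
[cite: Arapura2006, §4 Lemma 4.2] -/
theorem hodgeClasses_pow_motivated_of_isDominatedByPowers (hX : IsSmoothProjective dX X)
    (hY : IsSmoothProjective dY Y) (hdom : IsDominatedByPowers dY Y dX X)
    (hAC : ∀ (e d : ℕ) (a : complexBetti (X.pow e) (2 * d)), IsRationalClass a →
      IsOfHodgeType (e * dX) (X.pow e) (2 * d) d d a → a ∈ motivatedClasses (e * dX) (X.pow e) d)
    (j p : ℕ) {c : complexBetti (Y.pow (j + 1)) (2 * p)} (hc : IsRationalClass c)
    (hpp : IsOfHodgeType ((j + 1) * dY) (Y.pow (j + 1)) (2 * p) p p c) :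
    c ∈ motivatedClasses ((j + 1) * dY) (Y.pow (j + 1)) p :=
  hodgeClasses_motivated_of_isDominatedByPowers hX (hY.pow (j + 1)) (isDominatedByPowers_pow_succ hX hY hdom j) hAC p
    hc hpp

/-! ## §2 André's Thm. 0.6.2 (c2, displayed) on the cartesian powers of an abelian variety -/

/-- **c2 ⟹ `AC` on every cartesian power `A.Xᵉ`** (dimension `e · dim A`) of the underlying variety of a complex abelian
variety `A`: for `e = k + 1`, `A.X^{k+1} ≅ (A^{k+1}).X` is the variety of the abelian variety `A.powSucc k`
(`CorCM.Stage4.powSuccXIso`, `dim_powSucc'`), along which rational classes, Hodge types and motivated classes transport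
(`isRationalClass_map_iff_of_iso`, `isOfHodgeType_map_iff_of_iso`, `map_mem_motivatedClasses_iff_of_iso`); for `e = 0`
the power is `Spec ℂ`, whose degree-`0` classes are algebraic, hence motivated (André §2.1 «il est clair», the tree's
`algebraicClasses_le_motivatedClasses_of_nonempty_hardLefschetzNFold_self`), and whose higher cohomology vanishes.
c2 is the displayed hypothesis `hAM`, NOT asserted. [cite: Andre1996Motifs, Thm. 0.6.2 (p. 9) and §2.1 (p. 14)] -/
theorem hodgeClasses_pow_motivated_of_andre1996 (hAM : Andre1996_hodgeClasses_abelianVariety_motivated)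
    (A : AbelianVariety ℂ) :
    ∀ (e d : ℕ) (a : complexBetti (A.X.pow e) (2 * d)), IsRationalClass a →
      IsOfHodgeType (e * A.dim) (A.X.pow e) (2 * d) d d a → a ∈ motivatedClasses (e * A.dim) (A.X.pow e) d
  | 0, d, a, _, _ => by
    have hP : IsSmoothProjective (0 * A.dim) (A.X.pow 0) := (AbelianVariety.isSmoothProjective_holds (A := A)).pow 0
    rcases Nat.eq_zero_or_pos d with rfl | hd
    · refine algebraicClasses_le_motivatedClasses_of_nonempty_hardLefschetzNFold_self hP
        (nonempty_hardLefschetzNFold_holds _ _) 0 ?_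
      rw [algebraicClasses_zero]
      exact Submodule.mem_top
    · haveI := subsingleton_complexBetti hP (show 2 * (0 * A.dim) < 2 * d by omega)
      rw [Subsingleton.elim a 0]
      exact Submodule.zero_mem _
  | k + 1, d, a, ha, hpp => by
    have hB : IsSmoothProjective ((k + 1) * A.dim) (A.powSucc k).X := by
      have h' : IsSmoothProjective (A.powSucc k).dim (A.powSucc k).X := AbelianVariety.isSmoothProjective_holds
      rwa [dim_powSucc'] at h'
    have hP : IsSmoothProjective ((k + 1) * A.dim) (A.X.pow (k + 1)) :=
      (AbelianVariety.isSmoothProjective_holds (A := A)).pow (k + 1)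
    have ha' : IsRationalClass (complexBetti.map (powSuccXIso A k).hom (2 * d) a) :=
      (isRationalClass_map_iff_of_iso (powSuccXIso A k)).2 ha
    have hpp' : IsOfHodgeType ((k + 1) * A.dim) (A.powSucc k).X (2 * d) d d
        (complexBetti.map (powSuccXIso A k).hom (2 * d) a) :=
      (isOfHodgeType_map_iff_of_iso (powSuccXIso A k)).2 hpp
    have hmot' : complexBetti.map (powSuccXIso A k).hom (2 * d) a ∈
        motivatedClasses ((k + 1) * A.dim) (A.powSucc k).X d := by
      have h := hAM (A.powSucc k) AbelianVariety.isSmoothProjective_holds d _ ha'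
      rw [dim_powSucc'] at h
      exact h hpp'
    exact (map_mem_motivatedClasses_iff_of_iso hP hB (powSuccXIso A k) a).1 hmot'

/-! ## §3 Cor. 4.4 (strong form) modulo c2: `AC` on the strict abelian class -/

section StrictAbelian

/-- **ARAPURA 2006 COR. 4.4 (strong-domination form), MODULO c2: every Hodge class on a smooth projective variety
dominated by the powers of a complex abelian variety is MOTIVATED.** For `Y` of dimension `dY` with
`IsDominatedByPowers dY Y A.dim A.X` and a rational class `c` of type `(p,p)`: `c ∈ A_motᵖ(Y)_ℂ`, granted André's
Thm. 0.6.2 (the tree's named fact c2 `Andre1996_hodgeClasses_abelianVariety_motivated`, displayed hypothesis `hAM`, a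
THEOREM in print, NOT asserted here). §1 fed by §2. [cite: Arapura2006, §4 Cor. 4.4 and Lemma 4.2]
[cite: Andre1996Motifs, Thm. 0.6.2 (p. 9)] -/
theorem hodgeClasses_motivated_of_isDominatedByPowers_abelianVariety
    (hAM : Andre1996_hodgeClasses_abelianVariety_motivated) (A : AbelianVariety ℂ) (hY : IsSmoothProjective dY Y)
    (hdom : IsDominatedByPowers dY Y A.dim A.X) (p : ℕ) {c : complexBetti Y (2 * p)} (hc : IsRationalClass c)
    (hpp : IsOfHodgeType dY Y (2 * p) p p c) : c ∈ motivatedClasses dY Y p :=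
  hodgeClasses_motivated_of_isDominatedByPowers AbelianVariety.isSmoothProjective_holds hY hdom
    (hodgeClasses_pow_motivated_of_andre1996 hAM A) p hc hpp

/-- **`AC` on Arapura's strict abelian class, modulo c2** (existential packaging `∃ A, IsDominatedByPowers dY Y A.dim A.X`,
the hypothesis of the tree's `CorCM.Stage4.hc_of_exists_isDominatedByPowers_abelianVariety`, whose `HC_AV`-twin this is).
[cite: Arapura2006, §4 Cor. 4.4] [cite: Andre1996Motifs, Thm. 0.6.2 (p. 9)] -/
theorem hodgeClasses_motivated_of_exists_isDominatedByPowers_abelianVariety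
    (hAM : Andre1996_hodgeClasses_abelianVariety_motivated) (hY : IsSmoothProjective dY Y)
    (h : ∃ A : AbelianVariety ℂ, IsDominatedByPowers dY Y A.dim A.X) (p : ℕ) {c : complexBetti Y (2 * p)}
    (hc : IsRationalClass c) (hpp : IsOfHodgeType dY Y (2 * p) p p c) : c ∈ motivatedClasses dY Y p := by
  obtain ⟨A, hA⟩ := h
  exact hodgeClasses_motivated_of_isDominatedByPowers_abelianVariety hAM A hY hA p hc hpp

/-- **… with all powers `Y^{j+1}`** («then `AC` holds for all powers of `Y`»). [cite: Arapura2006, §4 Cor. 4.4 and Lemma 4.2] -/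
theorem hodgeClasses_pow_motivated_of_exists_isDominatedByPowers_abelianVariety
    (hAM : Andre1996_hodgeClasses_abelianVariety_motivated) (hY : IsSmoothProjective dY Y)
    (h : ∃ A : AbelianVariety ℂ, IsDominatedByPowers dY Y A.dim A.X) (j p : ℕ)
    {c : complexBetti (Y.pow (j + 1)) (2 * p)} (hc : IsRationalClass c)
    (hpp : IsOfHodgeType ((j + 1) * dY) (Y.pow (j + 1)) (2 * p) p p c) :
    c ∈ motivatedClasses ((j + 1) * dY) (Y.pow (j + 1)) p := by
  obtain ⟨A, hA⟩ := h
  exact hodgeClasses_pow_motivated_of_isDominatedByPowers AbelianVariety.isSmoothProjective_holds hY hA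
    (hodgeClasses_pow_motivated_of_andre1996 hAM A) j p hc hpp

/-- **… products**: `AC` on `Y ⊗ Y'` for `Y`, `Y'` in the strict abelian class, modulo c2
(`CorCM.Stage4.exists_isDominatedByPowers_tensor`). [cite: Arapura2006, §4 Cor. 4.4] -/
theorem hodgeClasses_tensor_motivated_of_exists_isDominatedByPowers_abelianVariety {dY' : ℕ} {Y' : SchemeOver ℂ}
    (hAM : Andre1996_hodgeClasses_abelianVariety_motivated) (hY : IsSmoothProjective dY Y)
    (hY' : IsSmoothProjective dY' Y') (h : ∃ A : AbelianVariety ℂ, IsDominatedByPowers dY Y A.dim A.X)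
    (h' : ∃ B : AbelianVariety ℂ, IsDominatedByPowers dY' Y' B.dim B.X) (p : ℕ) {c : complexBetti (Y ⊗ Y') (2 * p)}
    (hc : IsRationalClass c) (hpp : IsOfHodgeType (dY + dY') (Y ⊗ Y') (2 * p) p p c) :
    c ∈ motivatedClasses (dY + dY') (Y ⊗ Y') p :=
  hodgeClasses_motivated_of_exists_isDominatedByPowers_abelianVariety hAM (hY.tensor_holds hY')
    (CorCM.Stage4.exists_isDominatedByPowers_tensor hY hY' h h') p hc hpp

/-- **… smooth surjective images**: if `Z` lies in the strict abelian class and `f : Z ⟶ Y` is surjective onto a smooth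
projective `Y`, then `AC(Y)` modulo c2 (`CorCM.Stage4.exists_isDominatedByPowers_of_surjective`).
[cite: Arapura2006, §1 Cor. 1.2 and §4 Cor. 4.4] -/
theorem hodgeClasses_motivated_of_surjective_of_exists_isDominatedByPowers_abelianVariety {dZ : ℕ} {Z : SchemeOver ℂ}
    (hAM : Andre1996_hodgeClasses_abelianVariety_motivated) (hZ : IsSmoothProjective dZ Z)
    (hY : IsSmoothProjective dY Y) (f : Z ⟶ Y) [AlgebraicGeometry.Surjective f.left]
    (h : ∃ B : AbelianVariety ℂ, IsDominatedByPowers dZ Z B.dim B.X) (p : ℕ) {c : complexBetti Y (2 * p)}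
    (hc : IsRationalClass c) (hpp : IsOfHodgeType dY Y (2 * p) p p c) : c ∈ motivatedClasses dY Y p :=
  hodgeClasses_motivated_of_exists_isDominatedByPowers_abelianVariety hAM hY
    (exists_isDominatedByPowers_of_surjective hZ hY f h) p hc hpp

end StrictAbelian

end Summit.HodgeConjecture.HodgeConjecture.Theorems

end
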